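import Mathlib
import Literature.NumberTheory.LFunctions.WeilArchimedeanPositivityProofs
import Literature.NumberTheory.LFunctions.WeilArchimedeanMoments
import Literature.Analysis.SpecialFunctions.DigammaVerticalSeries
import Summits.RiemannHypothesis.RiemannHypothesis.Theorems.WeilGroundStateGroundStateSimpleEvenStubOddEnvelope
import Summits.RiemannHypothesis.RiemannHypothesis.Theorems.WeilGroundStateGroundStateSimpleEvenStubBathtub
import Summits.RiemannHypothesis.RiemannHypothesis.Theorems.WeilGroundStateGroundStateSimpleEvenStubDigammaMinorant
import HarnessLib

/-!
# The odd-sector lower bound by a Fourier bathtub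

Stub `stub_oddLowerGeneric` (GEN) for the line *parity–multiplicity–commutator* of the crux
`GroundStateSimpleEven` (Weil ground state).

For an odd normalised test function `g` on the window `[-c, c]`, `c ≤ (log 2)/2` (no prime
enters), Yoshida's analytic form reads
`Re Q(g) = P − log π + (1/2π) ∫ |ĝ(1/2+it)|² Re ψ(1/4+it/2) dt` with the polar term
`P ≥ −2(sinh c − c)` (`Yoshida1992_polar_lower_bound`). Replace `Re ψ(1/4 + it/2)` by the
logarithmic minorant `m` of `stub_reDigammaQuarter_ge` (minorant principle), and apply the
bathtub principle `stub_bathtub` with density `f = |ĝ(1/2+it)|²` (total mass `2π` by Plancherel),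
cap `F(t) = c E(c|t|)` (it dominates `f` by the odd Fourier envelope `stub_oddFourierEnvelope`
and the hypothesis on `E`), weight `m` (non-decreasing in `|t|`, `m(11) > 0`) and radius
`R = u₁/c ≥ 11`: `∫_{[-R,R]} F m ≤ ∫ f m`. By evenness and the substitution `u = ct` the cap
side equals `2 ∫₀^{u₁} E(u) m(u/c) du`.
-/

open Set MeasureTheory Filter Complex
open scoped Real Topology ComplexConjugate
open Literature.NumberTheory.LFunctions
open Literature.Analysis.SpecialFunctions

namespace Summit.RiemannHypothesis.RiemannHypothesis.Theorems

namespace GroundStateSimpleEven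

/-! ### The explicit minorant `m(t) = Re ψ(1/4) + 16t²/(1+4t²) + 4t²/(5(25/4+t²))
  + 2t²/(9(81/4+t²)) + (1/2) log(1 + 4t²/81)` -/

set_option linter.dupNamespace false in
/-- The minorant is measurable. [folklore] -/
theorem gen_minorant_measurable :
    Measurable fun t : ℝ ↦ reDigammaQuarter 0 + 16 * t ^ 2 / (1 + 4 * t ^ 2) +
      4 * t ^ 2 / (5 * (25 / 4 + t ^ 2)) + 2 * t ^ 2 / (9 * (81 / 4 + t ^ 2)) +
      Real.log (1 + 4 * t ^ 2 / 81) / 2 := by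
  fun_prop

set_option linter.dupNamespace false in
/-- The minorant is non-decreasing in `|t|` (each summand is a non-decreasing function of `t²`).
[folklore] -/
theorem gen_minorant_mono {s t : ℝ} (h : |s| ≤ |t|) :
    reDigammaQuarter 0 + 16 * s ^ 2 / (1 + 4 * s ^ 2) + 4 * s ^ 2 / (5 * (25 / 4 + s ^ 2)) +
        2 * s ^ 2 / (9 * (81 / 4 + s ^ 2)) + Real.log (1 + 4 * s ^ 2 / 81) / 2 ≤
      reDigammaQuarter 0 + 16 * t ^ 2 / (1 + 4 * t ^ 2) + 4 * t ^ 2 / (5 * (25 / 4 + t ^ 2)) +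
        2 * t ^ 2 / (9 * (81 / 4 + t ^ 2)) + Real.log (1 + 4 * t ^ 2 / 81) / 2 := by
  have hst : s ^ 2 ≤ t ^ 2 := sq_le_sq.2 h
  have hs : 0 ≤ s ^ 2 := sq_nonneg s
  have h1 : 16 * s ^ 2 / (1 + 4 * s ^ 2) ≤ 16 * t ^ 2 / (1 + 4 * t ^ 2) := by
    rw [div_le_div_iff₀ (by positivity) (by positivity)]
    nlinarith
  have h2 : 4 * s ^ 2 / (5 * (25 / 4 + s ^ 2)) ≤ 4 * t ^ 2 / (5 * (25 / 4 + t ^ 2)) := by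
    rw [div_le_div_iff₀ (by positivity) (by positivity)]
    nlinarith
  have h3 : 2 * s ^ 2 / (9 * (81 / 4 + s ^ 2)) ≤ 2 * t ^ 2 / (9 * (81 / 4 + t ^ 2)) := by
    rw [div_le_div_iff₀ (by positivity) (by positivity)]
    nlinarith
  have h4 : Real.log (1 + 4 * s ^ 2 / 81) ≤ Real.log (1 + 4 * t ^ 2 / 81) :=
    Real.log_le_log (by positivity) (by linarith)
  linarith

set_option linter.dupNamespace false in
/-- Quadratic growth: `|m(t)| ≤ |Re ψ(1/4)| + 27 t²` (`Re ψ(1/4) ≤ m ≤ Re ψ(1/4 + it/2)`).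
[folklore] -/
theorem gen_minorant_abs_le (t : ℝ) :
    |reDigammaQuarter 0 + 16 * t ^ 2 / (1 + 4 * t ^ 2) + 4 * t ^ 2 / (5 * (25 / 4 + t ^ 2)) +
        2 * t ^ 2 / (9 * (81 / 4 + t ^ 2)) + Real.log (1 + 4 * t ^ 2 / 81) / 2| ≤
      |reDigammaQuarter 0| + 27 * t ^ 2 := by
  have h1 := stub_reDigammaQuarter_ge t
  have h2 := abs_reDigammaQuarter_le t
  have h3 : 0 ≤ Real.log (1 + 4 * t ^ 2 / 81) :=
    Real.log_nonneg (le_add_of_nonneg_right (by positivity))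
  have h4 : 0 ≤ 16 * t ^ 2 / (1 + 4 * t ^ 2) := by positivity
  have h5 : 0 ≤ 4 * t ^ 2 / (5 * (25 / 4 + t ^ 2)) := by positivity
  have h6 : 0 ≤ 2 * t ^ 2 / (9 * (81 / 4 + t ^ 2)) := by positivity
  have h7 := sq_nonneg t
  rw [abs_le]
  constructor
  · linarith [neg_abs_le (reDigammaQuarter 0)]
  · linarith [le_abs_self (reDigammaQuarter t)]

set_option linter.dupNamespace false in
/-- Positivity at `t = 11`: `m(11) ≥ −4.22745354 + 1936/485 + 1936/2545 + 968/5085 > 0`.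
[folklore] -/
theorem gen_minorant_eleven_nonneg :
    0 ≤ reDigammaQuarter 0 + 16 * (11 : ℝ) ^ 2 / (1 + 4 * (11 : ℝ) ^ 2) +
      4 * (11 : ℝ) ^ 2 / (5 * (25 / 4 + (11 : ℝ) ^ 2)) +
      2 * (11 : ℝ) ^ 2 / (9 * (81 / 4 + (11 : ℝ) ^ 2)) +
      Real.log (1 + 4 * (11 : ℝ) ^ 2 / 81) / 2 := by
  have h1 := re_digamma_one_quarter_ge
  rw [← reDigammaQuarter_zero] at h1
  have h2 : 0 ≤ Real.log (1 + 4 * (11 : ℝ) ^ 2 / 81) := Real.log_nonneg (by norm_num)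
  have h3 : (49 : ℝ) / 10 ≤ 16 * (11 : ℝ) ^ 2 / (1 + 4 * (11 : ℝ) ^ 2) +
      4 * (11 : ℝ) ^ 2 / (5 * (25 / 4 + (11 : ℝ) ^ 2)) +
      2 * (11 : ℝ) ^ 2 / (9 * (81 / 4 + (11 : ℝ) ^ 2)) := by
    norm_num
  linarith

/-! ### The cap side: evenness and the substitution `u = c t` -/

set_option linter.dupNamespace false in
/-- For `G(t) = H(c|t|)` integrable on `[-R, R]` (`c > 0`, `R ≥ 0`):
`∫_{[-R,R]} G = (2/c) ∫₀^{cR} H`. [folklore] -/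
theorem gen_setIntegral_comp_abs {G H : ℝ → ℝ} {c R : ℝ} (hc : 0 < c) (hR : 0 ≤ R)
    (hGH : ∀ t, G t = H (c * |t|)) (hint : IntegrableOn G (Icc (-R) R)) :
    ∫ t in Icc (-R) R, G t = 2 / c * ∫ u in (0 : ℝ)..(c * R), H u := by
  have hRR : -R ≤ R := by linarith
  have hii : IntervalIntegrable G volume (-R) R :=
    (intervalIntegrable_iff_integrableOn_Icc_of_le hRR).2 hint
  have h1 : IntervalIntegrable G volume (-R) 0 :=
    hii.mono_set (by rw [uIcc_of_le (by linarith), uIcc_of_le hRR]; exact Icc_subset_Icc le_rfl hR)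
  have h2 : IntervalIntegrable G volume 0 R :=
    hii.mono_set (by rw [uIcc_of_le hR, uIcc_of_le hRR]; exact Icc_subset_Icc (by linarith) le_rfl)
  rw [integral_Icc_eq_integral_Ioc, ← intervalIntegral.integral_of_le hRR,
    ← intervalIntegral.integral_add_adjacent_intervals h1 h2]
  have e1 : ∫ t in (-R)..0, G t = ∫ t in (0 : ℝ)..R, H (c * t) := by
    have e : ∫ t in (-R)..0, G t = ∫ t in (-R)..0, H (c * -t) := by
      refine intervalIntegral.integral_congr fun t ht ↦ ?_
      rw [uIcc_of_le (by linarith)] at ht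
      simp only [hGH, abs_of_nonpos ht.2]
    rw [e, intervalIntegral.integral_comp_neg (fun s ↦ H (c * s)), neg_zero, neg_neg]
  have e2 : ∫ t in (0 : ℝ)..R, G t = ∫ t in (0 : ℝ)..R, H (c * t) := by
    refine intervalIntegral.integral_congr fun t ht ↦ ?_
    rw [uIcc_of_le hR] at ht
    simp only [hGH, abs_of_nonneg ht.1]
  rw [e1, e2, intervalIntegral.integral_comp_mul_left H hc.ne', mul_zero, smul_eq_mul]
  ring

set_option linter.dupNamespace false in
/-- The sinc envelope is an even function of `ct`:
`c − sin(2ct)/(2t) = c (1 − sin(2u)/(2u))` with `u = c|t|` (both sides equal `c` at `t = 0`).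
[folklore] -/
theorem gen_envelope_abs {c : ℝ} (hc : 0 < c) (t : ℝ) :
    c - Real.sin (2 * c * t) / (2 * t) =
      c * (1 - Real.sin (2 * (c * |t|)) / (2 * (c * |t|))) := by
  rcases lt_trichotomy t 0 with ht | rfl | ht
  · rw [abs_of_neg ht, show 2 * (c * -t) = -(2 * c * t) by ring, Real.sin_neg]
    have hc' := hc.ne'
    have ht' := ht.ne
    field_simp
  · simp
  · rw [abs_of_pos ht, show 2 * (c * t) = 2 * c * t by ring]
    have hc' := hc.ne'
    have ht' := ht.ne'
    field_simp

/-! ### The Fourier bathtub for an abstract admissible weight -/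

set_option linter.dupNamespace false in
/-- **Fourier bathtub, abstract weight.** If `m` is a measurable minorant of `Re ψ(1/4 + it/2)`
of quadratic growth, non-decreasing in `|t|` with `m(11) ≥ 0`, then for every odd normalised
test function `g` on `[-c, c]` (`c ≤ (log 2)/2`) and every bounded measurable `E` dominating the
sinc envelope with `∫₀^{u₁} E ≤ π`, `u₁ ≥ 11c`:
`−2(sinh c − c) − log π + (1/π) ∫₀^{u₁} E(u) m(u/c) du ≤ Re Q(g)`. [folklore] -/
theorem gen_lower_of_minorant {c : ℝ} (hc : 0 < c) (hc2 : c ≤ Real.log 2 / 2) {E : ℝ → ℝ}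
    {B u₁ : ℝ} (hEm : Measurable E) (hEB : ∀ u, |E u| ≤ B)
    (hE : ∀ u, 0 ≤ u → 1 - Real.sin (2 * u) / (2 * u) ≤ E u) (hu₁ : 11 * c ≤ u₁)
    (hEπ : ∫ u in (0 : ℝ)..u₁, E u ≤ π) {g : ℝ → ℂ} (hg : IsWeilTest g)
    (hsupp : tsupport g ⊆ Icc (-c) c) (hodd : ∀ x, g (-x) = -g x)
    (hnorm : ∫ x, ‖g x‖ ^ 2 = (1 : ℝ)) {m : ℝ → ℝ} (hmm : Measurable m) {A₀ : ℝ} (hA₀ : 0 ≤ A₀)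
    (hmb : ∀ t, |m t| ≤ A₀ + 27 * t ^ 2) (hmle : ∀ t, m t ≤ reDigammaQuarter t)
    (hmono : ∀ s t, |s| ≤ |t| → m s ≤ m t) (hm11 : 0 ≤ m 11) :
    -(2 * (Real.sinh c - c)) - Real.log π + 1 / π * ∫ u in (0 : ℝ)..u₁, E u * m (u / c) ≤
      (weilQuadratic g).re := by
  -- the radius `R = u₁ / c ≥ 11`
  set R : ℝ := u₁ / c with hR
  have hR11 : 11 ≤ R := by rw [hR, le_div_iff₀ hc]; linarith
  have hR0 : 0 ≤ R := by linarith
  have hcR : c * R = u₁ := by rw [hR]; field_simp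
  have hB : 0 ≤ B := (abs_nonneg _).trans (hEB 0)
  -- the density `f = |ĝ(1/2 + it)|²` and the cap `F(t) = c E(c|t|)`
  have hf0 : ∀ t : ℝ, 0 ≤ ‖weilMellin g (1 / 2 + t * I)‖ ^ 2 := fun t ↦ by positivity
  have hfF : ∀ t : ℝ, ‖weilMellin g (1 / 2 + t * I)‖ ^ 2 ≤ c * E (c * |t|) := by
    intro t
    have h1 := stub_oddFourierEnvelope c hc g hg hsupp hodd t
    rw [hnorm, mul_one, gen_envelope_abs hc t] at h1
    exact h1.trans (mul_le_mul_of_nonneg_left (hE _ (by positivity)) hc.le)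
  have hmR : 0 ≤ m R :=
    hm11.trans (hmono 11 R (by rw [abs_of_nonneg hR0, abs_of_nonneg (by norm_num)]; exact hR11))
  -- integrability
  have hfi : Integrable fun t : ℝ ↦ ‖weilMellin g (1 / 2 + t * I)‖ ^ 2 :=
    integrable_norm_sq_weilMellin_half_line hg
  have hfmi : Integrable fun t : ℝ ↦ ‖weilMellin g (1 / 2 + t * I)‖ ^ 2 * m t :=
    integrable_norm_sq_weilMellin_mul hg hmm hA₀ (by norm_num) hmb
  have hFm : Measurable fun t : ℝ ↦ c * E (c * |t|) :=
    (hEm.comp (measurable_const.mul measurable_abs)).const_mul c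
  have hFbd : ∀ t : ℝ, |c * E (c * |t|)| ≤ c * B := fun t ↦ by
    rw [abs_mul, abs_of_pos hc]
    exact mul_le_mul_of_nonneg_left (hEB _) hc.le
  have hFi : IntegrableOn (fun t : ℝ ↦ c * E (c * |t|)) (Icc (-R) R) :=
    Measure.integrableOn_of_bounded measure_Icc_lt_top.ne hFm.aestronglyMeasurable
      (M := c * B) (ae_of_all _ fun t ↦ by rw [Real.norm_eq_abs]; exact hFbd t)
  have hFmi : IntegrableOn (fun t : ℝ ↦ c * E (c * |t|) * m t) (Icc (-R) R) := by
    refine Measure.integrableOn_of_bounded measure_Icc_lt_top.ne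
      (hFm.mul hmm).aestronglyMeasurable (M := c * B * (A₀ + 27 * R ^ 2)) ?_
    refine ae_restrict_of_forall_mem measurableSet_Icc fun t ht ↦ ?_
    rw [Real.norm_eq_abs, abs_mul]
    have ht2 : t ^ 2 ≤ R ^ 2 := sq_le_sq' ht.1 ht.2
    have h2 : |m t| ≤ A₀ + 27 * R ^ 2 := (hmb t).trans (by linarith)
    exact mul_le_mul (hFbd t) h2 (abs_nonneg _) (by positivity)
  -- the masses: `∫ f = 2π` (Plancherel) and `∫_{[-R,R]} F = 2 ∫₀^{u₁} E ≤ 2π`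
  have hPl : ∫ t : ℝ, ‖weilMellin g (1 / 2 + t * I)‖ ^ 2 = 2 * π := by
    rw [integral_norm_sq_weilMellin_half_line hg, weilNorm2Sq, hnorm, mul_one]
  have hcapF : ∫ t in Icc (-R) R, c * E (c * |t|) = 2 * ∫ u in (0 : ℝ)..u₁, E u := by
    rw [gen_setIntegral_comp_abs (G := fun t ↦ c * E (c * |t|)) (H := fun u ↦ c * E u) hc hR0
      (fun _ ↦ rfl) hFi, hcR, intervalIntegral.integral_const_mul]
    field_simp
  have hmass : ∫ t in Icc (-R) R, c * E (c * |t|) ≤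
      ∫ t : ℝ, ‖weilMellin g (1 / 2 + t * I)‖ ^ 2 := by
    rw [hcapF, hPl]
    linarith
  -- the bathtub
  have hbath := stub_bathtub (fun t : ℝ ↦ ‖weilMellin g (1 / 2 + t * I)‖ ^ 2)
    (fun t ↦ c * E (c * |t|)) m R hR0 hf0 hfF hmono hmR hfi hfmi hFi hFmi hmass
  -- the cap side of the bathtub: `∫_{[-R,R]} F m = 2 ∫₀^{u₁} E(u) m(u/c) du`
  have hev : ∀ t : ℝ, m |t| = m t := fun t ↦
    le_antisymm (hmono _ _ (abs_abs t).le) (hmono _ _ (abs_abs t).ge)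
  have hcapFm : ∫ t in Icc (-R) R, c * E (c * |t|) * m t =
      2 * ∫ u in (0 : ℝ)..u₁, E u * m (u / c) := by
    have key : ∀ t : ℝ, c * E (c * |t|) * m t = c * (E (c * |t|) * m (c * |t| / c)) := by
      intro t
      rw [mul_div_cancel_left₀ _ hc.ne', hev, mul_assoc]
    rw [gen_setIntegral_comp_abs (G := fun t ↦ c * E (c * |t|) * m t)
      (H := fun u ↦ c * (E u * m (u / c))) hc hR0 key hFmi, hcR,
      intervalIntegral.integral_const_mul]
    field_simp
  -- Yoshida's analytic form and the minorant principle
  have hsupp' : tsupport g ⊆ Icc (-(Real.log 2 / 2)) (Real.log 2 / 2) :=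
    hsupp.trans (Icc_subset_Icc (neg_le_neg hc2) hc2)
  have hQ : (weilQuadratic g).re =
      2 * (weilMellin g 0 * conj (weilMellin g 1)).re - Real.log π * (∫ t : ℝ, ‖g t‖ ^ 2) +
        1 / (2 * π) * ∫ t : ℝ, ‖weilMellin g (1 / 2 + t * I)‖ ^ 2 * reDigammaQuarter t := by
    rw [weilQuadratic_re_eq_weilArchQuadratic hg hsupp']
    exact weilArchQuadratic_eq g
  have hP := Yoshida1992_polar_lower_bound hg hsupp
  rw [hnorm, mul_one] at hP
  have hA := integral_norm_sq_weilMellin_mul_mono hg hmm hA₀ (by norm_num) hmb hmle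
  have hJ : 2 * ∫ u in (0 : ℝ)..u₁, E u * m (u / c) ≤
      ∫ t : ℝ, ‖weilMellin g (1 / 2 + t * I)‖ ^ 2 * reDigammaQuarter t := by
    rw [← hcapFm]
    exact hbath.trans hA
  have hπ := Real.pi_pos
  have hJ' := mul_le_mul_of_nonneg_left hJ (by positivity : (0 : ℝ) ≤ 1 / (2 * π))
  have e : 1 / (2 * π) * (2 * ∫ u in (0 : ℝ)..u₁, E u * m (u / c)) =
      1 / π * ∫ u in (0 : ℝ)..u₁, E u * m (u / c) := by
    field_simp
  rw [hQ, hnorm, mul_one]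
  linarith

end GroundStateSimpleEven

set_option linter.dupNamespace false in
/-- **The odd-sector lower bound (GEN), Fourier bathtub.** For `0 < c ≤ (log 2)/2`, a bounded
measurable cap profile `E` dominating the sinc envelope `1 − sin(2u)/(2u)` on `u ≥ 0` with
`∫₀^{u₁} E ≤ π`, `u₁ ≥ 11c`, and every odd test function `g` on `[-c, c]` with `‖g‖₂ = 1`:
`−2(sinh c − c) − log π + (1/π) ∫₀^{u₁} E(u) m(u/c) du ≤ Re Q(g)`, where
`m(t) = Re ψ(1/4) + 16t²/(1+4t²) + 4t²/(5(25/4+t²)) + 2t²/(9(81/4+t²)) + (1/2) log(1+4t²/81)` is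
the logarithmic minorant of `Re ψ(1/4 + it/2)`. Proof: `Re Q = P − log π + (1/2π) A`
(Yoshida (2.1)), `P ≥ −2(sinh c − c)` (Yoshida (6.2)–(6.3)), `A ≥ ∫ |ĝ|² m` (minorant principle)
`≥ ∫_{[-R,R]} c E(c|t|) m(t) dt = 2 ∫₀^{u₁} E(u) m(u/c) du` (bathtub with the odd Fourier
envelope `|ĝ(1/2+it)|² ≤ c − sin(2ct)/(2t) ≤ c E(c|t|)`, Plancherel `∫ |ĝ|² = 2π`, `R = u₁/c`).
[folklore] -/
theorem stub_oddLowerGeneric :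
    ∀ c : ℝ, 0 < c → c ≤ Real.log 2 / 2 → ∀ (E : ℝ → ℝ) (B u₁ : ℝ), Measurable E →
      (∀ u, |E u| ≤ B) → (∀ u, 0 ≤ u → 1 - Real.sin (2 * u) / (2 * u) ≤ E u) → 11 * c ≤ u₁ →
      ∫ u in (0 : ℝ)..u₁, E u ≤ Real.pi →
      ∀ g : ℝ → ℂ, IsWeilTest g → tsupport g ⊆ Icc (-c) c → (∀ x, g (-x) = -g x) →
        ∫ x, ‖g x‖ ^ 2 = (1 : ℝ) →
        -(2 * (Real.sinh c - c)) - Real.log Real.pi +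
          1 / Real.pi * ∫ u in (0 : ℝ)..u₁, E u *
            (Literature.Analysis.SpecialFunctions.reDigammaQuarter 0 +
              16 * (u / c) ^ 2 / (1 + 4 * (u / c) ^ 2) +
              4 * (u / c) ^ 2 / (5 * (25 / 4 + (u / c) ^ 2)) +
              2 * (u / c) ^ 2 / (9 * (81 / 4 + (u / c) ^ 2)) +
              Real.log (1 + 4 * (u / c) ^ 2 / 81) / 2) ≤ (weilQuadratic g).re := by
  intro c hc hc2 E B u₁ hEm hEB hE hu₁ hEπ g hg hsupp hodd hnorm
  exact GroundStateSimpleEven.gen_lower_of_minorant hc hc2 hEm hEB hE hu₁ hEπ hg hsupp hodd hnorm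
    (m := fun t : ℝ ↦ reDigammaQuarter 0 + 16 * t ^ 2 / (1 + 4 * t ^ 2) +
      4 * t ^ 2 / (5 * (25 / 4 + t ^ 2)) + 2 * t ^ 2 / (9 * (81 / 4 + t ^ 2)) +
      Real.log (1 + 4 * t ^ 2 / 81) / 2)
    GroundStateSimpleEven.gen_minorant_measurable (abs_nonneg (reDigammaQuarter 0))
    GroundStateSimpleEven.gen_minorant_abs_le stub_reDigammaQuarter_ge
    (fun _ _ h ↦ GroundStateSimpleEven.gen_minorant_mono h)
    GroundStateSimpleEven.gen_minorant_eleven_nonneg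

end Summit.RiemannHypothesis.RiemannHypothesis.Theorems
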